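import Summits.QuantumAdvantage.AdviceFreeQNC0.GraphHLF
import HarnessLib

/-!
# Cell qa-qnc0 (rung F-Q1, route RingFrame, crux α `RingToElim`): the sign bit of a graph's HLF form is
# ADDITIVE on the kernel (symmetric, loop-free adjacency) — engine of the repaired no-go N3

Planner qa-qnc0-p2 gen 7 (`HOME/qa-qnc0-p2/ROUND-7.md` §4 door D-G, `line/Sketch7.lean` N3; statements
`InKernelG`/`edgesInG`/`signBitG` in `GraphHLF.lean`).  For an adjacency `adj` that is SYMMETRIC with ZERO
DIAGONAL (a graph `G`) and an instance `x`:

* `GraphN3.wtAnd_even` — `|x ∧ v|` is even for every kernel vector `v ∈ Ker(A_G + diag x)`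
  (`Σ_b v_b·(deg_v(b) + x_b v_b) = 2e(G[v]) + |x∧v|` is a sum of even numbers; `B_self`, `sum_pairs_symm`);
* `GraphN3.signBitG_xor` — **additivity**: `ℓ_x(v ⊕ v') ≡ ℓ_x(v) + ℓ_x(v') (mod 2)` for kernel vectors,
  `ℓ_x(v) = e(G[v]) + |x∧v|/2`.  Proof in `ℕ`: `|x∧(v⊕v')| + 2|x∧v∧v'| = |x∧v| + |x∧v'|` (`wtAnd_xor`),
  `e(G[v⊕v']) + 2R = e(G[v]) + e(G[v']) + B(v,v')` with `B(v,v') = Σ_{b~b'} v_b v'_{b'}` (`edgesInG_xor`,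
  per-pair identity `pair_identity`, symmetrisation over ordered pairs), and `B(v,v') + |x∧v∧v'|` is even
  because `v'` is a kernel vector (`B_add_even`);
* `GraphN3.inKernelG_xor`, `inKernelG_zero`, `signBitG_zero` — the kernel is a subspace containing `0`.

This is exactly what fails with loops (`not_fewTypesEasy`, `GraphHLF.lean`).  Consumer: `FewTypesEasyGraph.lean`.
WHAT THIS IS NOT: nothing on α; separation NOT moved.
-/

noncomputable section

namespace Summit.QuantumAdvantage.AdviceFreeQNC0

open Finset
open Literature.Computability.QuantumComplexity Literature.Computability.QuantumComplexity.RingHLF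
open Literature.Computability.MetaComplexity Literature.Computability.MetaComplexity.Smolensky

namespace GraphN3

variable {m : ℕ} (adj : Fin m → Fin m → Bool) (x : Fin m → Bool)

/-- `[b]` as a natural number. -/
def indN (b : Bool) : ℕ := if b = true then 1 else 0

/-! ### The kernel condition and the sign bit as sums -/

/-- The kernel test at vertex `b`: `deg_v(b) + [x_b ∧ v_b]`. -/
def kt (v : Fin m → Bool) (b : Fin m) : ℕ :=
  ∑ b' : Fin m, indN (adj b b' && v b') + indN (x b && v b)

/-- The kernel condition as the vanishing mod `2` of the kernel tests. -/
theorem inKernelG_iff (v : Fin m → Bool) : InKernelG adj x v ↔ ∀ b, kt adj x v b % 2 = 0 := by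
  unfold InKernelG kt indN
  refine forall_congr' fun b => ?_
  rw [Finset.card_filter]
  have h1 : ∀ b', (if (adj b b' = true ∧ v b' = true) then 1 else 0) =
      (if (adj b b' && v b') = true then 1 else 0) := fun b' => by
    cases adj b b' <;> cases v b' <;> rfl
  have h2 : (if (x b = true ∧ v b = true) then 1 else 0) = (if (x b && v b) = true then 1 else 0) := by
    cases x b <;> cases v b <;> rfl
  simp only [h1, h2]

/-- `|x ∧ v|` as a sum. -/
theorem wtAnd_eq (v : Fin m → Bool) : wtAnd x v = ∑ b : Fin m, indN (x b && v b) := by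
  unfold wtAnd indN
  rw [Finset.card_filter]
  refine Finset.sum_congr rfl fun b _ => ?_
  cases x b <;> cases v b <;> rfl

/-- The ordered-pair form `B(v,v') = Σ_{b,b'} adj_{bb'} v_b v'_{b'}`. -/
def B (v v' : Fin m → Bool) : ℕ := ∑ b : Fin m, ∑ b' : Fin m, indN (adj b b' && (v b && v' b'))

/-- `e(G[v])` as a sum over ordered pairs `b < b'`. -/
theorem edgesInG_eq (v : Fin m → Bool) :
    edgesInG adj v = ∑ e : Fin m × Fin m, (if e.1 < e.2 then indN (adj e.1 e.2 && (v e.1 && v e.2)) else 0) := by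
  unfold edgesInG indN
  rw [Finset.card_filter]
  refine Finset.sum_congr rfl fun e _ => ?_
  by_cases h : e.1 < e.2
  · rw [if_pos h]; cases adj e.1 e.2 <;> cases v e.1 <;> cases v e.2 <;> simp [h]
  · rw [if_neg h]; simp [h]

variable {adj}

/-- Symmetrisation: for symmetric loop-free `adj`, the ordered-pair sum is twice-the-unordered plus
its transpose: `Σ_{b,b'} adj·s(b,b') = Σ_{b<b'} adj·(s(b,b') + s(b',b))`. -/
theorem sum_pairs_symm (hs : ∀ a b, adj a b = adj b a) (hl : ∀ a, adj a a = false)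
    (s : Fin m → Fin m → ℕ) :
    ∑ b : Fin m, ∑ b' : Fin m, indN (adj b b') * s b b' =
      ∑ e : Fin m × Fin m, (if e.1 < e.2 then indN (adj e.1 e.2) * (s e.1 e.2 + s e.2 e.1) else 0) := by
  rw [← Fintype.sum_prod_type' (fun b b' => indN (adj b b') * s b b')]
  -- split the ordered pairs into `<`, `=`, `>`
  have hsplit : ∀ e : Fin m × Fin m, indN (adj e.1 e.2) * s e.1 e.2 =
      (if e.1 < e.2 then indN (adj e.1 e.2) * s e.1 e.2 else 0) +
        (if e.2 < e.1 then indN (adj e.1 e.2) * s e.1 e.2 else 0) := by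
    intro e
    rcases lt_trichotomy e.1 e.2 with h | h | h
    · rw [if_pos h, if_neg (not_lt.2 h.le), add_zero]
    · rw [if_neg (by rw [h]; exact lt_irrefl _), if_neg (by rw [h]; exact lt_irrefl _), h, hl]
      simp [indN]
    · rw [if_neg (not_lt.2 h.le), if_pos h, zero_add]
  rw [Finset.sum_congr rfl fun e _ => hsplit e, Finset.sum_add_distrib]
  -- the `>` part is the `<` part transposed
  have hswap : ∑ e : Fin m × Fin m, (if e.2 < e.1 then indN (adj e.1 e.2) * s e.1 e.2 else 0) =
      ∑ e : Fin m × Fin m, (if e.1 < e.2 then indN (adj e.1 e.2) * s e.2 e.1 else 0) := by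
    rw [← Equiv.sum_comp (Equiv.prodComm (Fin m) (Fin m))
      (fun e : Fin m × Fin m => if e.1 < e.2 then indN (adj e.1 e.2) * s e.2 e.1 else 0)]
    refine Finset.sum_congr rfl fun e _ => ?_
    simp only [Equiv.prodComm_apply, Prod.fst_swap, Prod.snd_swap]
    rw [hs e.2 e.1]
  rw [hswap, ← Finset.sum_add_distrib]
  refine Finset.sum_congr rfl fun e _ => ?_
  by_cases h : e.1 < e.2
  · rw [if_pos h, if_pos h, if_pos h]; ring
  · rw [if_neg h, if_neg h, if_neg h]

/-- `B(v,v) = 2·e(G[v])`. -/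
theorem B_self (hs : ∀ a b, adj a b = adj b a) (hl : ∀ a, adj a a = false) (v : Fin m → Bool) :
    B adj v v = 2 * edgesInG adj v := by
  unfold B
  have h := sum_pairs_symm hs hl (fun b b' => indN (v b && v b'))
  have e1 : ∀ b b', indN (adj b b' && (v b && v b')) = indN (adj b b') * indN (v b && v b') := fun b b' => by
    unfold indN; cases adj b b' <;> cases v b <;> cases v b' <;> rfl
  simp only [e1]
  rw [h, edgesInG_eq, Finset.mul_sum]
  refine Finset.sum_congr rfl fun e _ => ?_
  by_cases hlt : e.1 < e.2
  · rw [if_pos hlt, if_pos hlt]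
    unfold indN; cases adj e.1 e.2 <;> cases v e.1 <;> cases v e.2 <;> rfl
  · rw [if_neg hlt, if_neg hlt]; rfl

/-- `Σ_b v_b · kt(v')(b) = B(v,v') + |x ∧ v ∧ v'|`. -/
theorem sum_mul_kt (v v' : Fin m → Bool) :
    ∑ b : Fin m, indN (v b) * kt adj x v' b = B adj v v' + ∑ b : Fin m, indN (x b && (v b && v' b)) := by
  unfold kt B
  rw [← Finset.sum_add_distrib]
  refine Finset.sum_congr rfl fun b _ => ?_
  rw [mul_add, Finset.mul_sum]
  congr 1
  · refine Finset.sum_congr rfl fun b' _ => ?_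
    unfold indN; cases v b <;> cases adj b b' <;> cases v' b' <;> rfl
  · unfold indN; cases v b <;> cases x b <;> cases v' b <;> rfl

/-- If `v'` is a kernel vector then `B(v,v') + |x ∧ v ∧ v'|` is even. -/
theorem B_add_even (v v' : Fin m → Bool) (hv' : InKernelG adj x v') :
    (B adj v v' + ∑ b : Fin m, indN (x b && (v b && v' b))) % 2 = 0 := by
  rw [← sum_mul_kt, Finset.sum_nat_mod]
  rw [inKernelG_iff] at hv'
  have hz : ∀ b ∈ (univ : Finset (Fin m)), indN (v b) * kt adj x v' b % 2 = 0 := by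
    intro b _
    rw [Nat.mul_mod, hv' b, mul_zero, Nat.zero_mod]
  rw [Finset.sum_eq_zero hz, Nat.zero_mod]

/-- On the kernel `|x ∧ v|` is even. -/
theorem wtAnd_even (hs : ∀ a b, adj a b = adj b a) (hl : ∀ a, adj a a = false) (v : Fin m → Bool)
    (hv : InKernelG adj x v) : wtAnd x v % 2 = 0 := by
  have h := B_add_even x v v hv
  rw [B_self hs hl] at h
  have e : ∑ b : Fin m, indN (x b && (v b && v b)) = wtAnd x v := by
    rw [wtAnd_eq]; refine Finset.sum_congr rfl fun b _ => ?_; cases v b <;> rfl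
  rw [e] at h
  omega

/-- `|x ∧ (v ⊕ v')| + 2|x ∧ v ∧ v'| = |x ∧ v| + |x ∧ v'|`. -/
theorem wtAnd_xor (v v' : Fin m → Bool) :
    wtAnd x (fun b => xor (v b) (v' b)) + 2 * ∑ b : Fin m, indN (x b && (v b && v' b)) =
      wtAnd x v + wtAnd x v' := by
  rw [wtAnd_eq, wtAnd_eq, wtAnd_eq, Finset.mul_sum, ← Finset.sum_add_distrib, ← Finset.sum_add_distrib]
  refine Finset.sum_congr rfl fun b _ => ?_
  unfold indN; cases x b <;> cases v b <;> cases v' b <;> rfl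

/-- Per-pair bookkeeping for `e(G[v ⊕ v'])`. -/
def rr (a a' c c' : Bool) : ℕ :=
  indN (a && a') * (indN c + indN c') + indN (c && c') * (indN a + indN a') - 2 * indN (a && a' && c && c')

/-- The per-pair identity behind `e(G[v ⊕ v'])` (16 Boolean cases). -/
theorem pair_identity (a a' c c' : Bool) :
    indN (xor a a' && xor c c') + 2 * rr a a' c c' =
      indN (a && c) + indN (a' && c') + (indN (a && c') + indN (c && a')) := by
  unfold rr indN
  cases a <;> cases a' <;> cases c <;> cases c' <;> decide

/-- `e(G[v ⊕ v']) + 2R = e(G[v]) + e(G[v']) + B(v,v')`. -/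
theorem edgesInG_xor (hs : ∀ a b, adj a b = adj b a) (hl : ∀ a, adj a a = false) (v v' : Fin m → Bool) :
    ∃ R : ℕ, edgesInG adj (fun b => xor (v b) (v' b)) + 2 * R =
      edgesInG adj v + edgesInG adj v' + B adj v v' := by
  refine ⟨∑ e : Fin m × Fin m,
    (if e.1 < e.2 then indN (adj e.1 e.2) * rr (v e.1) (v' e.1) (v e.2) (v' e.2) else 0), ?_⟩
  have hB : B adj v v' = ∑ e : Fin m × Fin m,
      (if e.1 < e.2 then indN (adj e.1 e.2) * (indN (v e.1 && v' e.2) + indN (v e.2 && v' e.1)) else 0) := by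
    unfold B
    have e1 : ∀ b b', indN (adj b b' && (v b && v' b')) = indN (adj b b') * indN (v b && v' b') := fun b b' => by
      unfold indN; cases adj b b' <;> cases v b <;> cases v' b' <;> rfl
    simp only [e1]
    exact sum_pairs_symm hs hl _
  rw [hB, edgesInG_eq, edgesInG_eq, edgesInG_eq, Finset.mul_sum, ← Finset.sum_add_distrib,
    ← Finset.sum_add_distrib, ← Finset.sum_add_distrib]
  refine Finset.sum_congr rfl fun e _ => ?_
  by_cases hlt : e.1 < e.2
  · simp only [if_pos hlt]
    have hp := pair_identity (v e.1) (v' e.1) (v e.2) (v' e.2)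
    cases adj e.1 e.2
    · simp [indN]
    · have h1 : indN true = 1 := rfl
      simp only [Bool.true_and, h1, one_mul]
      omega
  · simp only [if_neg hlt, mul_zero, add_zero]

/-- **Additivity of the sign bit on the kernel** (symmetric, loop-free `adj`). -/
theorem signBitG_xor (hs : ∀ a b, adj a b = adj b a) (hl : ∀ a, adj a a = false) {v v' : Fin m → Bool}
    (hv : InKernelG adj x v) (hv' : InKernelG adj x v') :
    signBitG adj x (fun b => xor (v b) (v' b)) = (signBitG adj x v + signBitG adj x v') % 2 := by
  unfold signBitG
  obtain ⟨R, hR⟩ := edgesInG_xor hs hl v v'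
  have hX := wtAnd_xor x v v'
  have hK := B_add_even x v v' hv'
  have he := wtAnd_even x hs hl v hv
  have he' := wtAnd_even x hs hl v' hv'
  omega

/-- The kernel is closed under `⊕`. -/
theorem inKernelG_xor {v v' : Fin m → Bool} (hv : InKernelG adj x v) (hv' : InKernelG adj x v') :
    InKernelG adj x (fun b => xor (v b) (v' b)) := by
  rw [inKernelG_iff] at hv hv' ⊢
  intro b
  have h1 := hv b
  have h2 := hv' b
  unfold kt at h1 h2 ⊢
  show (∑ b', indN (adj b b' && xor (v b') (v' b')) + indN (x b && xor (v b) (v' b))) % 2 = 0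
  have hsum : ∑ b', indN (adj b b' && xor (v b') (v' b')) + 2 * ∑ b', indN (adj b b' && (v b' && v' b')) =
      ∑ b', indN (adj b b' && v b') + ∑ b', indN (adj b b' && v' b') := by
    rw [Finset.mul_sum, ← Finset.sum_add_distrib, ← Finset.sum_add_distrib]
    refine Finset.sum_congr rfl fun b' _ => ?_
    unfold indN; cases adj b b' <;> cases v b' <;> cases v' b' <;> rfl
  have hxb : indN (x b && xor (v b) (v' b)) + 2 * indN (x b && (v b && v' b)) =
      indN (x b && v b) + indN (x b && v' b) := by
    unfold indN; cases x b <;> cases v b <;> cases v' b <;> rfl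
  omega

/-- The zero vector is a kernel vector with sign bit `0`. -/
theorem inKernelG_zero : InKernelG adj x (fun _ => false) := by
  rw [inKernelG_iff]; intro b; unfold kt indN; simp

/-- The zero vector has sign bit `0`. -/
theorem signBitG_zero : signBitG adj x (fun _ => false) = 0 := by
  unfold signBitG edgesInG wtAnd; simp

end GraphN3

end Summit.QuantumAdvantage.AdviceFreeQNC0
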